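import Mathlib.Analysis.SpecialFunctions.Pow.Real
import Mathlib.Analysis.InnerProductSpace.PiL2
import Mathlib.Analysis.Normed.Module.FiniteDimension
import Literature.Probability.LatticeModels.AnisotropicIsing
import HarnessLib

/-!
# The layered corner theory `T₀(g)` on `ℝ² × ℤ` — an interface

Topic `Probability/LatticeModels` (definition item `defn-LayeredCornerTheory`, route
`CriticalPhenomena/Ising3DConformalLimit/PlanarCornerRotations`, idea card
rotations-from-planar-corner, definition request D2; D1 is `AnisotropicIsing`).

The route studies the nearest-neighbour Ising model on `ℤ³` with couplings `(1, 1, ε)` (in-plane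
`1`, interlayer `ε`) at the **weak-interlayer corner** of its critical surface, in the
*dimensional-crossover window*

`ε = g · a^{7/4}`, `β = β_c(2) − m · a`, mesh `a → 0⁺`, with `g > 0`, `m > 0` fixed:

each layer `ℤ² × {k}` is then a slightly supercritical-temperature planar Ising model whose
correlation length is `≍ 1/(m a)` lattice units, i.e. of order one in macroscopic units, and
`7/4 = γ_{2D} = φ` is the crossover exponent of lattice anisotropy, so that the interlayer energy
per macroscopic area and per pair of adjacent layers is of order `g` (Liu–Stanley 1972, 1973:
crossover exponent `φ = γ` for the layered couplings `(J, J, RJ)`; Cardy 1996, §4.2,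
eqs. (4.5)–(4.9): crossover scaling variable `D |t|^{-φ}`, crossover temperature
`t_X = D^{1/φ}`, shift of the critical temperature `t_c ∝ D^{1/φ}` — here `D = ε`, `t = m a`,
so `ε t^{-φ} = g m^{-7/4}` is constant along the window and the critical points of the layered
models sit at `β_c(2) − β_c(1,1,ε) ≍ ε^{4/7} ≍ a`). The card posits that the plus-state spin
`n`-point functions, at the lattice points `(([y/a]), k) ∈ ℤ² × ℤ` and renormalised by
`a^{-1/8}` per spin (the planar normalisation of Chelkak–Hongler–Izyurov 2015, Thm 1.1),
converge to the `n`-point functions `T n ((y₁,k₁), …, (yₙ,kₙ))` of a continuum theory on the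
stack `ℝ² × ℤ` of planar layers — informally, independent massive planar Ising magnetisation
fields `Φ_k` (Wu–McCoy–Tracy–Barouch 1976, Palmer–Tracy 1981; Camia–Garban–Newman 2016 and
Camia–Jiang–Newman 2020 for the near-critical fields) tilted by `exp (g ∑_k ∫ Φ_k Φ_{k+1})` —
which at `m = m_c(g)` is critical, is **exactly** invariant under in-plane Euclidean isometries,
and whose infrared scaling limits, read through the affine map `diag(1, 1, c)` (Cardy 1996, §3,
"Anisotropic scaling": lattice anisotropy with all `R_i² > 0` is removed by a rescaling of the
coordinates), are to be compared with the scaling limits of the critical isotropic model on `ℤ³`.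

This file supplies the **interface** for that object and nothing more:

* `LayeredPoint = ℝ² × ℤ`, `LayeredCorrFamily`, `LayeredNonCoincident n` (injective
  configurations; open, `isOpen_layeredNonCoincident`);
* the window: `cornerCoupling g a = (1, 1, g a^{7/4})`, `cornerBeta m a = β_c(2) − m a`,
  `cornerSite a (y, k) = (⌊y₀/a⌋, ⌊y₁/a⌋, k)`, the rescaled correlator
  `cornerRescaledCorr g m ρ n a p`
  `= ρ(a)^n ⟨∏ᵢ σ_{cornerSite a (p i)}⟩⁺_{(1,1,g a^{7/4}), β_c(2) − m a}` (the plus state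
  `anisoCorr` of `AnisotropicIsing`), the convergence predicate
  `HasCornerScalingLimit g m ρ T` (locally uniformly on non-coincident configurations as
  `a → 0⁺`, the shape of `HasPointwiseScalingLimit`), the criticality predicate
  `IsCornerCriticalMass g m` (`(β_c(2) − β_c(1,1,g a^{7/4})) / a → m`: the window parameter `m`
  is the rescaled position of the true critical points, i.e. `m = m_c(g)`), and the canonical
  renormalisation `cornerRenorm a = a^{-1/8}`;
* infrared limits: `inPlane x = (x₀, x₁)`, `irBlowup L c x = (L • (x₀,x₁), ⌊L c x₂⌋)` and
  `IsLayeredIRLimit T τ c S` (`τ(L)^n T n (irBlowup L c ∘ x) → S n x` as `L → ∞`, pointwise on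
  non-coincident `x`; the card's `irLimit T τ c S`);
* `structure LayeredCornerTheory (g : ℝ)`: a family `T` WITH its provenance data — a mass
  `mass = m_c(g) > 0` and a renormalisation `renorm > 0` on `(0,1]` such that
  `HasCornerScalingLimit g mass renorm T` and `IsCornerCriticalMass g mass` — and the axioms the
  route consumes: invariance under in-plane linear isometries (`O(2)`, reflections included),
  in-plane translations and the layer shift `k ↦ k + 1`; permutation symmetry; `T ≥ 0`;
  `T = 0` off non-coincident configurations (the route's normalisation); `T 2 > 0` off the
  diagonal.
* API: `layerShift_invariant_int` (all shifts `k ↦ k + j`), `T_zero` (`T 0 = 1`, a consequence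
  of the provenance clause: the empty spin product has expectation `1`), and
  `IsLayeredIRLimit.apply_linearIsometryEquiv_of_map_single_two` — **exact in-plane symmetry
  passes to infrared limits**: if `T` is invariant under in-plane linear isometries and `S` is
  an IR limit of `T`, then `S n (R x₁, …, R xₙ) = S n x` for every linear isometry `R` of `ℝ³` with
  `R e₃ = e₃` and every non-coincident `x` (the step "O(2)_z survives into every IR limit" of
  the card; elementary: `R = R' ⊕ 1` and uniqueness of limits).

## What is NOT here (by design)

* **No existence.** Whether `LayeredCornerTheory g` is inhabited for small `g > 0` is the
  route's construction statement (child `LayeredTheoryO2` of item `CornerTransfer`: tilted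
  independent massive planar fields, exponential moments, FKG/GKS, sharp critical curve
  `m_c(g) ≍ g^{4/7}`); `CornerUniversality` (every normalised admissible scaling limit of the
  critical model on `ℤ³` is, after `diag(1,1,c)`, an `IsLayeredIRLimit` of some instance) is
  its crux. Neither is asserted; there are no named facts in this file (D-0026).
* No claim that the axioms follow from the provenance clause (non-negativity, symmetry and
  translation invariance would follow from GKS and translation invariance of the plus state;
  `O(2)` invariance is the content of the route's planar input `PlanarMassiveIsotropy`); they are
  recorded as fields because the consumers quantify over instances.
* The field-theoretic description (magnetisation fields `Φ_k`, the tilt) is motivation only;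
  the interface is stated through `n`-point functions, like `CorrFamily` / `criticalCorr`.

## References

* [LiuStanley1972] L. L. Liu, H. E. Stanley, Phys. Lett. A 40 (1972) 272–274 — rigorous
  (GKS) results on crossover for lattice anisotropy `(J, J, RJ)`. Not held (metadata only).
* [LiuStanley1973] L. L. Liu, H. E. Stanley, Phys. Rev. B 8 (1973) 2279–2298 —
  quasi-two-dimensional systems, crossover temperature, crossover exponent `φ = γ`. Not held.
* [Cardy1996] J. Cardy, *Scaling and Renormalization in Statistical Physics* (CUP 1996), §4.2
  eqs. (4.5)–(4.9) (crossover exponent, `t_X = D^{1/φ}`, `t_c ∝ D^{1/φ}`); §3, "Anisotropic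
  scaling", eq. (3.65) (rescaling of coordinates). Held, pages read.
* [ChelkakHonglerIzyurov2015] D. Chelkak, C. Hongler, K. Izyurov, Ann. Math. 181 (2015),
  Thm 1.1 (`δ^{-n/8} E[σ_{x₁}⋯σ_{xₙ}] → ⟨σ…σ⟩`, planar critical).
* [CamiaGarbanNewman2016] F. Camia, C. Garban, C. M. Newman, AIHP 52 (2016),
  doi:10.1214/14-aihp643 (near-critical planar magnetisation field); [CamiaJiangNewman2020]
  CPAM 73 (2020); [PalmerTracy1981] Adv. Appl. Math. 2 (1981); [WuEtAl1976] PRB 13 (1976) —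
  the planar massive scaling theory behind the layers (motivation; not used formally).

## Design notes

* In-plane points are `EuclideanSpace ℝ (Fin 2)` and `ℝ³`-points `EuclideanSpace ℝ (Fin 3)` (as
  in `ScalingLimit` / `ConformalCovariance`, so that `≃ₗᵢ` and `NonCoincident` apply); the layer
  index is `ℤ` with the discrete topology, so "locally uniformly" is in the continuous
  coordinates at fixed layers.
* The renormalisation is a field `renorm : ℝ → ℝ`, positive on `(0,1]` (values elsewhere are
  irrelevant: the mesh filter is `𝓝[>] 0`), exactly as the route's items quantify
  "`ρ > 0` on `(0,1]`"; the canonical `cornerRenorm a = a^{-1/8}` is provided but not imposed.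
* `IsLayeredIRLimit` is pointwise convergence at each non-coincident `x` (as requested: this is
  what symmetry inheritance uses); a locally uniform version would only be stronger.
* Junk: `cornerSite a` divides by `a` (meaningless for `a ≤ 0`, never used there);
  `anisoCorr` is `limUnder`-valued (junk when the box limit diverges, as documented upstream).
-/

noncomputable section

open Filter Topology

namespace Literature.Probability.LatticeModels

/-! ### Points, configurations and correlation families on the stack `ℝ² × ℤ` -/

/-- A point of the layered space `ℝ² × ℤ`: an in-plane position `y ∈ ℝ²` and a layer index
`k ∈ ℤ` (the continuum limit of the layered lattice `ℤ² × ℤ` of weakly coupled planes,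
Liu–Stanley 1973, in which only the in-plane directions are rescaled). [folklore] -/
abbrev LayeredPoint : Type := EuclideanSpace ℝ (Fin 2) × ℤ

/-- A family of `n`-point functions on the stack `ℝ² × ℤ`, `T n ((y₁,k₁), …, (yₙ,kₙ))`, indexed
by `n : ℕ` and `p : Fin n → LayeredPoint` (the layered analogue of `CorrFamily`). [folklore] -/
abbrev LayeredCorrFamily : Type := (n : ℕ) → (Fin n → LayeredPoint) → ℝ

/-- The non-coincident configurations of `n` layered points: the injective
`p : Fin n → ℝ² × ℤ` (two points coincide iff they have the same in-plane position AND the same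
layer; the layered analogue of `NonCoincident`). [folklore] -/
def LayeredNonCoincident (n : ℕ) : Set (Fin n → LayeredPoint) :=
  {p | Function.Injective p}

/-- Membership in `LayeredNonCoincident n` is injectivity. [folklore] -/
@[simp] theorem mem_layeredNonCoincident {n : ℕ} (p : Fin n → LayeredPoint) :
    p ∈ LayeredNonCoincident n ↔ Function.Injective p := Iff.rfl

/-- The non-coincident layered configurations form an open set (a finite intersection of the
open sets `{pᵢ ≠ pⱼ}` in the Hausdorff space `(ℝ² × ℤ)ⁿ`). [folklore] -/
theorem isOpen_layeredNonCoincident (n : ℕ) : IsOpen (LayeredNonCoincident n) := by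
  simp only [LayeredNonCoincident, Function.Injective, Set.setOf_forall]
  refine isOpen_iInter_of_finite fun i => isOpen_iInter_of_finite fun j => ?_
  by_cases h : i = j
  · simp [h]
  · simp only [h, imp_false]
    exact isOpen_ne_fun (continuous_apply i) (continuous_apply j)

/-- A configuration of `n = 0` layered points is (vacuously) non-coincident. [folklore] -/
theorem mem_layeredNonCoincident_zero (p : Fin 0 → LayeredPoint) : p ∈ LayeredNonCoincident 0 :=
  Function.injective_of_subsingleton p

/-! ### The dimensional-crossover window at the weak-interlayer corner -/

/-- The **corner couplings** `(1, 1, g · a^{7/4})`: unit in-plane couplings and interlayer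
coupling `ε = g a^{7/4}` at mesh `a`, the exponent `7/4 = γ_{2D} = φ` being the crossover
exponent of lattice anisotropy (Liu–Stanley 1972/1973: `φ = γ`; Cardy 1996, §4.2: the crossover
scaling variable is `D |t|^{-φ}`, constant along the window `t = m a`, `D = g a^{7/4}`). A
coupling vector for `anisoCorr 3` / `anisoCriticalBeta 3` (`axisCoupling`).
[cite: Cardy1996, §4.2 eqs. (4.5)–(4.6)] -/
def cornerCoupling (g a : ℝ) : Fin 3 → ℝ :=
  ![1, 1, g * a ^ ((7 : ℝ) / 4)]

/-- In-plane coupling along the first axis is `1`. [folklore] -/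
@[simp] theorem cornerCoupling_zero (g a : ℝ) : cornerCoupling g a 0 = 1 := rfl

/-- In-plane coupling along the second axis is `1`. [folklore] -/
@[simp] theorem cornerCoupling_one (g a : ℝ) : cornerCoupling g a 1 = 1 := rfl

/-- The interlayer coupling is `ε = g a^{7/4}`. [folklore] -/
@[simp] theorem cornerCoupling_two (g a : ℝ) : cornerCoupling g a 2 = g * a ^ ((7 : ℝ) / 4) := rfl

/-- The **in-window inverse temperature** `β = β_c(2) − m a`: at distance `m a` on the
high-temperature side of the planar critical point `β_c(2) = criticalBeta 2`, so that each layer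
has correlation length `≍ (m a)⁻¹` lattice units (`ν_{2D} = 1`), of order one in macroscopic
units; `m > 0` is the mass parameter of the window (Cardy 1996, §4.2: reduced temperature `t` with
`D t^{-φ}` fixed). [cite: Cardy1996, §4.2 eqs. (4.5)–(4.6)] -/
def cornerBeta (m a : ℝ) : ℝ :=
  criticalBeta 2 - m * a

/-- At mesh `a = 0` (formally) the in-window inverse temperature is `β_c(2)`. [folklore] -/
@[simp] theorem cornerBeta_zero_right (m : ℝ) : cornerBeta m 0 = criticalBeta 2 := by
  simp [cornerBeta]

/-- The **lattice site of a layered point** at mesh `a`: `(y, k) ↦ (⌊y₀/a⌋, ⌊y₁/a⌋, k) ∈ ℤ³` — the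
in-plane position is discretised at mesh `a` (as `latticeApprox a y`), the layer index is kept.
Junk for `a ≤ 0` (never used: the mesh filter is `𝓝[>] 0`). [folklore] -/
def cornerSite (a : ℝ) (p : LayeredPoint) : Site 3 :=
  ![⌊p.1 0 / a⌋, ⌊p.1 1 / a⌋, p.2]

/-- First coordinate of `cornerSite`. [folklore] -/
@[simp] theorem cornerSite_zero (a : ℝ) (p : LayeredPoint) : cornerSite a p 0 = ⌊p.1 0 / a⌋ := rfl

/-- Second coordinate of `cornerSite`. [folklore] -/
@[simp] theorem cornerSite_one (a : ℝ) (p : LayeredPoint) : cornerSite a p 1 = ⌊p.1 1 / a⌋ := rfl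

/-- Third coordinate of `cornerSite` is the layer index. [folklore] -/
@[simp] theorem cornerSite_two (a : ℝ) (p : LayeredPoint) : cornerSite a p 2 = p.2 := rfl

/-- The in-plane part of `cornerSite a (y, k)` is the planar lattice approximation
`latticeApprox a y` of `ScalingLimit`. [folklore] -/
theorem cornerSite_eq_latticeApprox (a : ℝ) (p : LayeredPoint) (i : Fin 2) :
    cornerSite a p (Fin.castSucc i) = latticeApprox a p.1 i := by
  fin_cases i <;> rfl

/-- The **rescaled corner correlator** at mesh `a`: the plus-state `n`-point function of the
anisotropic model in the window, at the lattice sites of the layered points, renormalised by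
`ρ(a)` per spin,
`cornerRescaledCorr g m ρ n a p`
`= ρ(a)^n · ⟨∏ᵢ σ_{cornerSite a (p i)}⟩⁺_{(1,1,g a^{7/4}), β_c(2) − m a, 0}`
(`anisoCorr` of `AnisotropicIsing`; the shape of `rescaledCorrelator`, whose planar instance with
`ρ(δ) = δ^{-1/8}` is Chelkak–Hongler–Izyurov 2015, Thm 1.1).
[cite: ChelkakHonglerIzyurov2015, Thm 1.1] -/
def cornerRescaledCorr (g m : ℝ) (ρ : ℝ → ℝ) (n : ℕ) (a : ℝ) (p : Fin n → LayeredPoint) : ℝ :=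
  ρ a ^ n * anisoCorr 3 (cornerCoupling g a) (cornerBeta m a) n (fun i => cornerSite a (p i))

/-- Unfolding of `cornerRescaledCorr`. [folklore] -/
theorem cornerRescaledCorr_apply (g m : ℝ) (ρ : ℝ → ℝ) (n : ℕ) (a : ℝ)
    (p : Fin n → LayeredPoint) :
    cornerRescaledCorr g m ρ n a p =
      ρ a ^ n * anisoCorr 3 (cornerCoupling g a) (cornerBeta m a) n (fun i => cornerSite a (p i)) :=
  rfl

/-- **Joint (crossover-window) scaling limit.** The layered family `T` is the scaling limit of
the anisotropic model in the window with mass parameter `m` and renormalisation `ρ`: for every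
`n`, `ρ(a)^n ⟨∏ᵢ σ_{cornerSite a (p i)}⟩⁺_{(1,1,g a^{7/4}), β_c(2) − m a} → T n p` as `a → 0⁺`,
locally uniformly on the non-coincident configurations `p ∈ (ℝ² × ℤ)ⁿ` (the shape of
`HasPointwiseScalingLimit`, Chelkak–Hongler–Izyurov 2015, Thm 1.1, in the layered geometry; the
route's foreseen item `CrossoverWindowLimit`). [cite: ChelkakHonglerIzyurov2015, Thm 1.1] -/
def HasCornerScalingLimit (g m : ℝ) (ρ : ℝ → ℝ) (T : LayeredCorrFamily) : Prop :=
  ∀ n, TendstoLocallyUniformlyOn (cornerRescaledCorr g m ρ n) (T n) (𝓝[>] (0 : ℝ))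
    (LayeredNonCoincident n)

/-- **Criticality of the window (the corner critical curve).** `m` is the rescaled position of
the true critical points of the layered models: `(β_c(2) − β_c(1, 1, g a^{7/4})) / a → m` as
`a → 0⁺` (`anisoCriticalBeta 3`, onset of plus-state magnetisation), i.e.
`β_c(1,1,ε(a)) = β_c(2) − m a + o(a)` — the models of the window with parameter `m` are
asymptotically critical. With `ε = g a^{7/4}` this is the crossover shift law
`β_c(2) − β_c(1,1,ε) ∼ m g^{-4/7} · ε^{4/7}` (shift exponent `1/φ = 4/7`; Cardy 1996, §4.2,
eq. (4.9): `t_c ∝ D^{1/φ}`; Liu–Stanley 1973), and `m = m_c(g)` is the card's critical mass.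
[cite: Cardy1996, §4.2 eq. (4.9)] -/
def IsCornerCriticalMass (g m : ℝ) : Prop :=
  Tendsto (fun a : ℝ => (criticalBeta 2 - anisoCriticalBeta 3 (cornerCoupling g a)) / a)
    (𝓝[>] (0 : ℝ)) (𝓝 m)

/-- The **canonical corner renormalisation** `ρ(a) = a^{-1/8}` per spin (`Real.rpow`): the planar
critical normalisation `δ^{-1/8}` of Chelkak–Hongler–Izyurov 2015, Thm 1.1 (spin scaling
dimension `1/8`), which is the expected one in the window since at lattice distances `≪ a⁻¹`
the layers are decoupled critical planar models. Provided for the construction statement; the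
interface below allows any renormalisation positive on `(0,1]`.
[cite: ChelkakHonglerIzyurov2015, Thm 1.1] -/
def cornerRenorm (a : ℝ) : ℝ :=
  a ^ (-(1 / 8 : ℝ))

/-- `a^{-1/8} > 0` for `a > 0`. [folklore] -/
theorem cornerRenorm_pos {a : ℝ} (ha : 0 < a) : 0 < cornerRenorm a :=
  Real.rpow_pos_of_pos ha _

/-- In particular the canonical renormalisation is positive on the mesh range `(0,1]`, the
hypothesis shape `∀ a ∈ Set.Ioc 0 1, 0 < ρ a` used by the route. [folklore] -/
theorem cornerRenorm_pos_of_mem_Ioc {a : ℝ} (ha : a ∈ Set.Ioc (0 : ℝ) 1) : 0 < cornerRenorm a :=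
  cornerRenorm_pos ha.1

/-! ### Infrared scaling limits of a layered family -/

/-- The in-plane component `(x₀, x₁) ∈ ℝ²` of a point `x ∈ ℝ³` (orthogonal projection to
`e₃^⊥`, in coordinates). [folklore] -/
def inPlane (x : EuclideanSpace ℝ (Fin 3)) : EuclideanSpace ℝ (Fin 2) :=
  !₂[x 0, x 1]

/-- First coordinate of the in-plane component. [folklore] -/
@[simp] theorem inPlane_apply_zero (x : EuclideanSpace ℝ (Fin 3)) : inPlane x 0 = x 0 := rfl

/-- Second coordinate of the in-plane component. [folklore] -/
@[simp] theorem inPlane_apply_one (x : EuclideanSpace ℝ (Fin 3)) : inPlane x 1 = x 1 := rfl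

/-- `inPlane` is additive. [folklore] -/
@[simp] theorem inPlane_add (x y : EuclideanSpace ℝ (Fin 3)) :
    inPlane (x + y) = inPlane x + inPlane y := by
  ext i; fin_cases i <;> rfl

/-- `inPlane` commutes with scalars. [folklore] -/
@[simp] theorem inPlane_smul (c : ℝ) (x : EuclideanSpace ℝ (Fin 3)) :
    inPlane (c • x) = c • inPlane x := by
  ext i; fin_cases i <;> rfl

/-- The **infrared blow-up** of a point `x ∈ ℝ³` at scale `L` with anisotropy constant `c`:
the layered point `(L • (x₀, x₁), ⌊L c x₂⌋)` — in-plane coordinates dilated by `L`, the third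
coordinate dilated by `L c` and discretised to a layer index. The constant `c` is the affine
normalisation `diag(1, 1, c)` relating the layered theory to an isotropic limit (Cardy 1996, §3,
"Anisotropic scaling", eq. (3.65): anisotropy with all `R_i² > 0` is removed by rescaling the
coordinates). [cite: Cardy1996, §3 eq. (3.65)] -/
def irBlowup (L c : ℝ) (x : EuclideanSpace ℝ (Fin 3)) : LayeredPoint :=
  (L • inPlane x, ⌊L * c * x 2⌋)

/-- In-plane part of the infrared blow-up. [folklore] -/
@[simp] theorem irBlowup_fst (L c : ℝ) (x : EuclideanSpace ℝ (Fin 3)) :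
    (irBlowup L c x).1 = L • inPlane x := rfl

/-- Layer index of the infrared blow-up. [folklore] -/
@[simp] theorem irBlowup_snd (L c : ℝ) (x : EuclideanSpace ℝ (Fin 3)) :
    (irBlowup L c x).2 = ⌊L * c * x 2⌋ := rfl

/-- **Infrared scaling limit of a layered family** (the card's `irLimit T τ c S`): the family
`S : CorrFamily 3` on `ℝ³` is the infrared limit of `T` with renormalisation `τ` and anisotropy
constant `c` when, for every `n` and every NON-COINCIDENT `x ∈ (ℝ³)ⁿ`,
`τ(L)^n · T n ((L x₁∥, ⌊L c x₁₃⌋), …, (L xₙ∥, ⌊L c xₙ₃⌋)) → S n (x₁, …, xₙ)` as `L → ∞`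
(pointwise; values of `S` at coincident configurations are not constrained — the route
normalises them to `0`). The affine constant `c` is the coordinate rescaling of Cardy 1996, §3,
"Anisotropic scaling". [cite: Cardy1996, §3 eq. (3.65)] -/
def IsLayeredIRLimit (T : LayeredCorrFamily) (τ : ℝ → ℝ) (c : ℝ) (S : CorrFamily 3) : Prop :=
  ∀ n, ∀ x ∈ NonCoincident 3 n,
    Tendsto (fun L : ℝ => τ L ^ n * T n (fun i => irBlowup L c (x i))) atTop (𝓝 (S n x))

/-! ### The interface -/

/-- **The critical layered corner theory `T₀(g)` — interface, no existence.** An instance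
consists of a family `T` of `n`-point functions on the stack `ℝ² × ℤ` together with its
PROVENANCE from the Ising model on `ℤ³` at the weak-interlayer corner and the axioms the route
`PlanarCornerRotations` consumes:

* provenance: a mass `mass = m_c(g) > 0` and a renormalisation `renorm`, positive on `(0,1]`,
  such that `T` is the joint scaling limit of the plus-state correlations of the anisotropic
  model with couplings `(1, 1, g a^{7/4})` at `β = β_c(2) − mass · a`, at the lattice points
  `(⌊y/a⌋, k)`, renormalised by `renorm a` per spin, locally uniformly off coincidences
  (`HasCornerScalingLimit`), AND the window is critical: `(β_c(2) − β_c(1,1,g a^{7/4}))/a → mass`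
  (`IsCornerCriticalMass`);
* symmetry: invariance under in-plane linear isometries (`O(2)`, acting on the `ℝ²`-components),
  in-plane translations, the layer shift `k ↦ k + 1`, and permutations of the points;
* positivity / normalisation: `T ≥ 0`; `T n p = 0` whenever `p` is NOT non-coincident (the
  route's convention "`S = 0` off `NonCoincident`"); `T 2 p > 0` for non-coincident `p`.

Informally `T` is the law, through its moments, of a stack of massive continuum planar Ising
magnetisation fields `Φ_k` coupled ferromagnetically to nearest layers with strength `g` and
tuned to its critical curve (idea card rotations-from-planar-corner; crossover window after
Liu–Stanley 1973 and Cardy 1996, §4.2; planar normalisation after Chelkak–Hongler–Izyurov 2015,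
Thm 1.1). Whether an instance EXISTS (for small `g > 0`) is the route's construction statement
`LayeredTheoryO2` and is not asserted here; `g` is a bare parameter (instances are only expected
for `g > 0`: for `g = 0` the layers decouple and `two_point_pos` fails across layers). This is a
bundle of generic predicates; the physics is the route's. [folklore] -/
structure LayeredCornerTheory (g : ℝ) where
  /-- The `n`-point functions `T n ((y₁,k₁), …, (yₙ,kₙ))` of the layered theory. -/
  T : LayeredCorrFamily
  /-- The critical mass `m_c(g)`: the window parameter at which `T` is taken. -/
  mass : ℝ
  /-- The per-spin renormalisation `ρ(a)` of the lattice correlations (canonically `a^{-1/8}`,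
  `cornerRenorm`). -/
  renorm : ℝ → ℝ
  /-- `m_c(g) > 0` (the window lies strictly on the high-temperature side of `β_c(2)`). -/
  mass_pos : 0 < mass
  /-- The renormalisation is positive on the mesh range `(0, 1]`. -/
  renorm_pos : ∀ a ∈ Set.Ioc (0 : ℝ) 1, 0 < renorm a
  /-- Provenance: `T` is the joint scaling limit of the anisotropic `ℤ³` model in the crossover
  window `(1,1,g a^{7/4})`, `β_c(2) − mass · a`, renormalised by `renorm a` per spin. -/
  hasCornerScalingLimit : HasCornerScalingLimit g mass renorm T
  /-- Criticality: the true critical points of the layered models sit in the window at `mass`,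
  `(β_c(2) − β_c(1,1,g a^{7/4})) / a → mass`. -/
  isCornerCriticalMass : IsCornerCriticalMass g mass
  /-- Invariance under in-plane linear isometries `R ∈ O(2)` acting on the `ℝ²`-components. -/
  isometry_invariant : ∀ (n : ℕ) (R : EuclideanSpace ℝ (Fin 2) ≃ₗᵢ[ℝ] EuclideanSpace ℝ (Fin 2))
    (p : Fin n → LayeredPoint), T n (fun i => (R (p i).1, (p i).2)) = T n p
  /-- Invariance under in-plane translations `y ↦ y + v`. -/
  translation_invariant : ∀ (n : ℕ) (v : EuclideanSpace ℝ (Fin 2)) (p : Fin n → LayeredPoint),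
    T n (fun i => ((p i).1 + v, (p i).2)) = T n p
  /-- Invariance under the layer shift `k ↦ k + 1` (hence under all shifts,
  `layerShift_invariant_int`). -/
  layerShift_invariant : ∀ (n : ℕ) (p : Fin n → LayeredPoint),
    T n (fun i => ((p i).1, (p i).2 + 1)) = T n p
  /-- Symmetry under permutations of the `n` points. -/
  perm_invariant : ∀ (n : ℕ) (σ : Equiv.Perm (Fin n)) (p : Fin n → LayeredPoint),
    T n (fun i => p (σ i)) = T n p
  /-- Non-negativity (first Griffiths inequality in the limit). -/
  nonneg : ∀ (n : ℕ) (p : Fin n → LayeredPoint), 0 ≤ T n p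
  /-- Normalisation: `T n p = 0` at configurations that are not non-coincident. -/
  eq_zero_of_not_mem : ∀ (n : ℕ) (p : Fin n → LayeredPoint),
    p ∉ LayeredNonCoincident n → T n p = 0
  /-- Non-degeneracy: the two-point function is positive off the diagonal (all pairs of
  distinct layered points, across layers included). -/
  two_point_pos : ∀ p ∈ LayeredNonCoincident 2, 0 < T 2 p

/-- The rescaled corner correlator of the EMPTY configuration is `1` at every mesh: the empty
spin product is the constant observable `1`, every finite-volume Gibbs expectation of it is `1`,
and so is the box limit. [folklore] -/
theorem cornerRescaledCorr_zero (g m : ℝ) (ρ : ℝ → ℝ) (a : ℝ) (p : Fin 0 → LayeredPoint) :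
    cornerRescaledCorr g m ρ 0 a p = 1 := by
  have hmono : (spinMonomial fun i : Fin 0 => cornerSite a (p i)) = fun _ => (1 : ℝ) := by
    funext s
    simp [spinMonomial]
  have hconst : (fun L : ℕ => anisoExpect (cornerCoupling g a) (box 3 L) (cornerBeta m a) 0 .plus
      fun _ => (1 : ℝ)) = fun _ => 1 := by
    funext L
    simp [anisoExpect]
  simp only [cornerRescaledCorr, pow_zero, one_mul, anisoCorr, anisoPlusExpect, hmono, hconst]
  exact tendsto_const_nhds.limUnder_eq

namespace LayeredCornerTheory

variable {g : ℝ} (𝒯 : LayeredCornerTheory g)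

/-- The infrared-limit predicate of an instance: `𝒯.IsIRLimit τ c S ↔ IsLayeredIRLimit 𝒯.T τ c S`
(the card's `irLimit T τ c S`). [folklore] -/
abbrev IsIRLimit (τ : ℝ → ℝ) (c : ℝ) (S : CorrFamily 3) : Prop :=
  IsLayeredIRLimit 𝒯.T τ c S

/-- Invariance under ALL layer shifts `k ↦ k + j`, `j ∈ ℤ` (iterate the unit shift and its
inverse). [folklore] -/
theorem layerShift_invariant_int (n : ℕ) (j : ℤ) (p : Fin n → LayeredPoint) :
    𝒯.T n (fun i => ((p i).1, (p i).2 + j)) = 𝒯.T n p := by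
  induction j using Int.induction_on generalizing p with
  | zero => simp
  | succ k ih =>
    have h := 𝒯.layerShift_invariant n (fun i => ((p i).1, (p i).2 + (k : ℤ)))
    simp only at h
    rw [← ih p, ← h]
    congr 1
    funext i
    rw [add_assoc]
  | pred k ih =>
    have h := 𝒯.layerShift_invariant n (fun i => ((p i).1, (p i).2 + (-(k : ℤ) - 1)))
    simp only at h
    rw [← ih p, ← h]
    congr 1
    funext i
    congr 1
    ring

/-- The two-point function is symmetric: `T 2 (q, p) = T 2 (p, q)`. [folklore] -/
theorem two_point_symm (p q : LayeredPoint) : 𝒯.T 2 ![q, p] = 𝒯.T 2 ![p, q] := by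
  have h := 𝒯.perm_invariant 2 (Equiv.swap 0 1) ![p, q]
  rw [← h]
  congr 1
  funext i
  fin_cases i <;> rfl

/-- **`T 0 = 1`.** A consequence of the provenance clause alone: the `0`-point function of the
layered theory is the limit of the constant `1` (`cornerRescaledCorr_zero`). [folklore] -/
theorem T_zero (p : Fin 0 → LayeredPoint) : 𝒯.T 0 p = 1 := by
  have hlim := (𝒯.hasCornerScalingLimit 0).tendsto_at (mem_layeredNonCoincident_zero p)
  have h1 : Tendsto (fun a : ℝ => cornerRescaledCorr g 𝒯.mass 𝒯.renorm 0 a p) (𝓝[>] (0 : ℝ))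
      (𝓝 1) := by
    simp only [cornerRescaledCorr_zero]
    exact tendsto_const_nhds
  exact tendsto_nhds_unique hlim h1

end LayeredCornerTheory

/-! ### Exact in-plane symmetry passes to infrared limits -/

section StabE3

/-- The embedding `ℝ² → ℝ³`, `y ↦ (y₀, y₁, 0)` (right inverse of `inPlane` on `e₃^⊥`).
[folklore] -/
def planeEmbed (y : EuclideanSpace ℝ (Fin 2)) : EuclideanSpace ℝ (Fin 3) :=
  !₂[y 0, y 1, 0]

/-- Coordinates of `planeEmbed`. [folklore] -/
@[simp] theorem planeEmbed_apply_zero (y : EuclideanSpace ℝ (Fin 2)) : planeEmbed y 0 = y 0 := rfl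

/-- Coordinates of `planeEmbed`. [folklore] -/
@[simp] theorem planeEmbed_apply_one (y : EuclideanSpace ℝ (Fin 2)) : planeEmbed y 1 = y 1 := rfl

/-- Coordinates of `planeEmbed`. [folklore] -/
@[simp] theorem planeEmbed_apply_two (y : EuclideanSpace ℝ (Fin 2)) : planeEmbed y 2 = 0 := rfl

/-- `inPlane ∘ planeEmbed = id`. [folklore] -/
@[simp] theorem inPlane_planeEmbed (y : EuclideanSpace ℝ (Fin 2)) :
    inPlane (planeEmbed y) = y := by
  ext i; fin_cases i <;> rfl

/-- `planeEmbed` is additive. [folklore] -/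
theorem planeEmbed_add (y z : EuclideanSpace ℝ (Fin 2)) :
    planeEmbed (y + z) = planeEmbed y + planeEmbed z := by
  ext i; fin_cases i <;> simp [planeEmbed]

/-- `planeEmbed` commutes with scalars. [folklore] -/
theorem planeEmbed_smul (c : ℝ) (y : EuclideanSpace ℝ (Fin 2)) :
    planeEmbed (c • y) = c • planeEmbed y := by
  ext i; fin_cases i <;> simp [planeEmbed]

/-- Pythagoras in coordinates: `‖x‖² = ‖(x₀,x₁)‖² + x₂²`. [folklore] -/
theorem norm_sq_eq_norm_sq_inPlane_add_sq (x : EuclideanSpace ℝ (Fin 3)) :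
    ‖x‖ ^ 2 = ‖inPlane x‖ ^ 2 + (x 2) ^ 2 := by
  rw [EuclideanSpace.real_norm_sq_eq, EuclideanSpace.real_norm_sq_eq, Fin.sum_univ_three,
    Fin.sum_univ_two, inPlane_apply_zero, inPlane_apply_one]

/-- `‖planeEmbed y‖ = ‖y‖`. [folklore] -/
theorem norm_planeEmbed (y : EuclideanSpace ℝ (Fin 2)) : ‖planeEmbed y‖ = ‖y‖ := by
  have h := norm_sq_eq_norm_sq_inPlane_add_sq (planeEmbed y)
  rw [inPlane_planeEmbed, planeEmbed_apply_two] at h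
  have h' : ‖planeEmbed y‖ ^ 2 = ‖y‖ ^ 2 := by rw [h]; ring
  exact (sq_eq_sq₀ (norm_nonneg _) (norm_nonneg _)).1 h'

/-- Decomposition `x = (x₀, x₁, 0) + x₂ e₃`. [folklore] -/
theorem planeEmbed_inPlane_add_smul_single (x : EuclideanSpace ℝ (Fin 3)) :
    planeEmbed (inPlane x) + x 2 • EuclideanSpace.single 2 (1 : ℝ) = x := by
  ext i
  fin_cases i <;> simp [planeEmbed]

variable (R : EuclideanSpace ℝ (Fin 3) ≃ₗᵢ[ℝ] EuclideanSpace ℝ (Fin 3))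

/-- A linear isometry of `ℝ³` fixing `e₃` preserves the third coordinate:
`(R x)₂ = ⟪R x, e₃⟫ = ⟪R x, R e₃⟫ = ⟪x, e₃⟫ = x₂`. [folklore] -/
theorem apply_two_eq_of_map_single_two
    (hR : R (EuclideanSpace.single 2 1) = EuclideanSpace.single 2 1)
    (x : EuclideanSpace ℝ (Fin 3)) : R x 2 = x 2 := by
  have h := R.inner_map_map x (EuclideanSpace.single 2 (1 : ℝ))
  rw [hR, EuclideanSpace.inner_single_right, EuclideanSpace.inner_single_right] at h
  simpa using h

/-- The **in-plane part** of a linear isometry `R` of `ℝ³` fixing `e₃`: the map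
`y ↦ ((R (y,0))₀, (R (y,0))₁)`, a linear isometry of `ℝ²` (it is norm-preserving because
`(R (y, 0))₂ = 0`), upgraded to `ℝ² ≃ₗᵢ[ℝ] ℝ²` by finite-dimensionality. [folklore] -/
def inPlanePart (hR : R (EuclideanSpace.single 2 1) = EuclideanSpace.single 2 1) :
    EuclideanSpace ℝ (Fin 2) ≃ₗᵢ[ℝ] EuclideanSpace ℝ (Fin 2) :=
  LinearIsometry.toLinearIsometryEquiv
    { toFun := fun y => inPlane (R (planeEmbed y))
      map_add' := fun y z => by rw [planeEmbed_add, map_add, inPlane_add]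
      map_smul' := fun c y => by rw [planeEmbed_smul, map_smul, inPlane_smul]; rfl
      norm_map' := fun y => by
        have h := norm_sq_eq_norm_sq_inPlane_add_sq (R (planeEmbed y))
        rw [apply_two_eq_of_map_single_two R hR, planeEmbed_apply_two, R.norm_map,
          norm_planeEmbed] at h
        have h' : ‖inPlane (R (planeEmbed y))‖ ^ 2 = ‖y‖ ^ 2 := by rw [h]; ring
        exact (sq_eq_sq₀ (norm_nonneg _) (norm_nonneg _)).1 h' }
    rfl

/-- The in-plane part acts as `y ↦ inPlane (R (y, 0))`. [folklore] -/
@[simp] theorem inPlanePart_apply (hR : R (EuclideanSpace.single 2 1) = EuclideanSpace.single 2 1)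
    (y : EuclideanSpace ℝ (Fin 2)) : inPlanePart R hR y = inPlane (R (planeEmbed y)) := rfl

/-- `R = R' ⊕ 1` in coordinates: the in-plane component of `R x` is the in-plane part of `R`
applied to the in-plane component of `x`. [folklore] -/
theorem inPlane_apply_eq_inPlanePart
    (hR : R (EuclideanSpace.single 2 1) = EuclideanSpace.single 2 1)
    (x : EuclideanSpace ℝ (Fin 3)) : inPlane (R x) = inPlanePart R hR (inPlane x) := by
  conv_lhs => rw [← planeEmbed_inPlane_add_smul_single x]
  rw [map_add, map_smul, hR, inPlane_add, inPlane_smul, inPlanePart_apply]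
  have h0 : inPlane (EuclideanSpace.single 2 (1 : ℝ) : EuclideanSpace ℝ (Fin 3)) = 0 := by
    ext i; fin_cases i <;> simp
  rw [h0, smul_zero, add_zero]

/-- The infrared blow-up intertwines `R` (fixing `e₃`) with its in-plane part acting on the
`ℝ²`-component: `irBlowup L c (R x) = (R' (irBlowup L c x).1, (irBlowup L c x).2)`. [folklore] -/
theorem irBlowup_apply_eq
    (hR : R (EuclideanSpace.single 2 1) = EuclideanSpace.single 2 1) (L c : ℝ)
    (x : EuclideanSpace ℝ (Fin 3)) :
    irBlowup L c (R x) = (inPlanePart R hR (irBlowup L c x).1, (irBlowup L c x).2) := by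
  rw [irBlowup, irBlowup, apply_two_eq_of_map_single_two R hR, inPlane_apply_eq_inPlanePart R hR,
    map_smul]

/-- **Exact in-plane symmetry passes to infrared limits** (the card's step "O(2)_z survives into
every IR scaling limit of `T₀`"). If the layered family `T` is invariant under in-plane linear
isometries and `S` is an infrared limit of `T` (any renormalisation `τ`, any anisotropy constant
`c`), then `S n (R x₁, …, R xₙ) = S n (x₁, …, xₙ)` for every linear isometry `R` of `ℝ³` with
`R e₃ = e₃` and every non-coincident `x`: the two blown-up configurations differ by the in-plane
isometry `inPlanePart R`, so the two convergent sequences coincide, and limits are unique.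
(Exact symmetries of a theory are inherited by its scaling limits; elementary.) [folklore] -/
theorem IsLayeredIRLimit.apply_linearIsometryEquiv_of_map_single_two {T : LayeredCorrFamily}
    {τ : ℝ → ℝ} {c : ℝ} {S : CorrFamily 3}
    (hT : ∀ (n : ℕ) (R' : EuclideanSpace ℝ (Fin 2) ≃ₗᵢ[ℝ] EuclideanSpace ℝ (Fin 2))
      (p : Fin n → LayeredPoint), T n (fun i => (R' (p i).1, (p i).2)) = T n p)
    (hS : IsLayeredIRLimit T τ c S)
    (hR : R (EuclideanSpace.single 2 1) = EuclideanSpace.single 2 1)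
    {n : ℕ} {x : Fin n → EuclideanSpace ℝ (Fin 3)} (hx : x ∈ NonCoincident 3 n) :
    S n (fun i => R (x i)) = S n x := by
  have hRx : (fun i => R (x i)) ∈ NonCoincident 3 n :=
    (mem_nonCoincident _).2 (R.injective.comp ((mem_nonCoincident _).1 hx))
  have h1 := hS n _ hRx
  have h2 := hS n x hx
  have heq : (fun L : ℝ => τ L ^ n * T n (fun i => irBlowup L c (R (x i)))) =
      fun L : ℝ => τ L ^ n * T n (fun i => irBlowup L c (x i)) := by
    funext L
    simp only [irBlowup_apply_eq R hR]
    rw [hT n (inPlanePart R hR) (fun i => irBlowup L c (x i))]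
  rw [heq] at h1
  exact tendsto_nhds_unique h1 h2

/-- The same inheritance for an instance of the interface, in the conclusion shape of the
route's item `CornerTransfer` restricted to non-coincident configurations: every infrared limit
of a `LayeredCornerTheory` is invariant under the stabiliser of `e₃` in `O(3)`. [folklore] -/
theorem LayeredCornerTheory.irLimit_apply_of_map_single_two {g : ℝ} (𝒯 : LayeredCornerTheory g)
    {τ : ℝ → ℝ} {c : ℝ} {S : CorrFamily 3} (hS : 𝒯.IsIRLimit τ c S)
    (hR : R (EuclideanSpace.single 2 1) = EuclideanSpace.single 2 1)
    {n : ℕ} {x : Fin n → EuclideanSpace ℝ (Fin 3)} (hx : x ∈ NonCoincident 3 n) :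
    S n (fun i => R (x i)) = S n x :=
  hS.apply_linearIsometryEquiv_of_map_single_two R 𝒯.isometry_invariant hR hx

end StabE3

end Literature.Probability.LatticeModels
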